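import Summits.BirchSwinnertonDyer.BirchSwinnertonDyer.Theorems.ClassRecordThreeRegCertKernel
import Summits.BirchSwinnertonDyer.BirchSwinnertonDyer.Theorems.ClassRecordThreeRegCertKernelO2Height
import HarnessLib

/-!
# Route `ClassRecordThree`, crux `SchneiderAtThree` (item 19106): the SECOND-ORDER REG3CERT kernel certificate checker
# (`v₃(e(Q)) = 1`, `v₃(h(Q)) ≤ 2`) — from one row's integers to `RegMult.CertNonsplit W 3 Q 1`
# (cell `bsd-stepL`, seat `bsd-stepL-reg3-eng` g3; `--supports stmt-BirchSwinnertonDyer-19106`)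

HONEST FRAMING: BSD is not proved by any of this; nothing here closes the crux; Schneider's conjecture (barrier
`PAdicHeightNondegeneracy`) is asserted NOWHERE; every application is ONE curve. Second-order twin of
`…RegCertKernel.certNonsplit_of_residueCert`: the bundled integer hypothesis now also carries `Δ` in terms of the `aᵢ`
(THE Tate parameter enters through `1/j(W) = Δ/c₄³`), `γ (mod 27)`, `ω, κ (mod 3⁵)` and the certificate
**`3⁴ ∤ 6E − 3E² + 2E³ − 6U + 3U² − 2U³`** (`E = e'⁴ − 1`, `U = u² − 1`); the height inequality is
`heightFourOneCoord_ne_zero_of_residueCertO2`, which uses the clause `j(q) = j(W)` of `RegMult.CertNonsplit`.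
Theorems only (0 defs, 0 facts). References: [SteinWuthrich2013] §4.2; [MazurSteinTate2006] §1; [SilvermanAEC2009]
VII.3.4; [SilvermanATAEC1994] V.5.1.
-/

open scoped Classical

open WeierstrassCurve Literature.NumberTheory.EllipticCurves
  Literature.NumberTheory.EllipticCurves.Rank1Residual
  Literature.NumberTheory.EllipticCurves.SteinWuthrich2013
  Summit.BirchSwinnertonDyer.Rank1Residual
  Summit.BirchSwinnertonDyer.Rank1Residual.X11b

namespace Summit.BirchSwinnertonDyer.Rank1Residual.X11b.RegMult.KernelCert

/-- `1/j(W) = Δ/c₄³` read in `ℚ₃`, for the integer model with `c₄` and `Δ` given by the standard integer formulas.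
[Silverman AEC III.1] [cite: SilvermanAEC2009, III.1] -/
theorem ratCast_j_inv_eq (W : WeierstrassCurve ℚ) {a₁ a₂ a₃ a₄ a₆ : ℤ} (hW : W = ⟨a₁, a₂, a₃, a₄, a₆⟩)
    [W.IsElliptic] {c4 D : ℤ} (hc4 : c4 = (a₁ ^ 2 + 4 * a₂) ^ 2 - 24 * (2 * a₄ + a₁ * a₃))
    (hD : D = -(a₁ ^ 2 + 4 * a₂) ^ 2 * (a₁ ^ 2 * a₆ + 4 * a₂ * a₆ - a₁ * a₃ * a₄ + a₂ * a₃ ^ 2 - a₄ ^ 2) -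
      8 * (2 * a₄ + a₁ * a₃) ^ 3 - 27 * (a₃ ^ 2 + 4 * a₆) ^ 2 + 9 * (a₁ ^ 2 + 4 * a₂) * (2 * a₄ + a₁ * a₃) * (a₃ ^ 2 + 4 * a₆)) :
    ((W.j : ℚ_[3]))⁻¹ = (D : ℚ_[3]) / (c4 : ℚ_[3]) ^ 3 := by
  have hΔ : W.Δ = (D : ℚ) := by
    subst hW; subst hD
    simp only [WeierstrassCurve.Δ, WeierstrassCurve.b₂, WeierstrassCurve.b₄, WeierstrassCurve.b₆, WeierstrassCurve.b₈]
    push_cast; ring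
  have hc4' : W.c₄ = (c4 : ℚ) := by
    subst hW; subst hc4
    simp only [WeierstrassCurve.c₄, WeierstrassCurve.b₂, WeierstrassCurve.b₄]
    push_cast; ring
  have hj : W.j = (c4 : ℚ) ^ 3 / (D : ℚ) := by
    rw [WeierstrassCurve.j, Units.val_inv_eq_inv_val, WeierstrassCurve.coe_Δ', hΔ, hc4', div_eq_mul_inv, mul_comm]
  rw [hj]; push_cast; rw [inv_div]

/-- **`RegMult.CertNonsplit W 3 Q 1` from a SECOND-ORDER REG3CERT residue certificate (`v₃(e(Q)) = 1`).** As
`certNonsplit_of_residueCert`, with the bundled integer hypothesis `H` extended by `Δ` (integer formula), `3 ∤ c₄`,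
`3 ∣ Δ`, the second-order residues `γ (mod 27)` (`27 ∣ c₄c₄³ + γc₆(c₄³ + 240Δ)`), `ω` (`3⁵ ∣ ℓ² − ωγ`),
`κ` (`3⁷ ∣ 360ω + 30ω² + ω³ − 720κ`), `9u = 2γκ`, `3 ∤ u`, and the certificate **`3⁴ ∤ 6E − 3E² + 2E³ − 6U + 3U² − 2U³`**
(`E = e'⁴ − 1`, `U = u² − 1`) — ONE `norm_num` per row. Decides the REG3CERT rows with `v₃(e(Q)) = 1`, `v₃(h(Q)) ≤ 2`.
Per curve; nothing class-wide. [cite: SteinWuthrich2013, §4.2] [cite: MazurSteinTate2006, §1] [cite: SilvermanAEC2009, VII.3.4] -/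
theorem certNonsplit_of_residueCertO2 (W : WeierstrassCurve ℚ) {a₁ a₂ a₃ a₄ a₆ : ℤ} (hW : W = ⟨a₁, a₂, a₃, a₄, a₆⟩)
    [W.IsElliptic] [W.IsGloballyMinimal] {a b c4 c6 D γ ζ ℓ ω κ u : ℤ} {e' n : ℕ}
    (H : c4 = (a₁ ^ 2 + 4 * a₂) ^ 2 - 24 * (2 * a₄ + a₁ * a₃) ∧
      c6 = -(a₁ ^ 2 + 4 * a₂) ^ 3 + 36 * (a₁ ^ 2 + 4 * a₂) * (2 * a₄ + a₁ * a₃) - 216 * (a₃ ^ 2 + 4 * a₆) ∧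
      D = -(a₁ ^ 2 + 4 * a₂) ^ 2 * (a₁ ^ 2 * a₆ + 4 * a₂ * a₆ - a₁ * a₃ * a₄ + a₂ * a₃ ^ 2 - a₄ ^ 2) -
        8 * (2 * a₄ + a₁ * a₃) ^ 3 - 27 * (a₃ ^ 2 + 4 * a₆) ^ 2 +
        9 * (a₁ ^ 2 + 4 * a₂) * (2 * a₄ + a₁ * a₃) * (a₃ ^ 2 + 4 * a₆) ∧
      ¬ (3 : ℤ) ∣ c4 ∧ ¬ (3 : ℤ) ∣ c6 ∧ (3 : ℤ) ∣ D ∧ ¬ (3 : ℤ) ∣ e' ∧ ¬ (3 : ℤ) ∣ b ∧ Nat.Coprime a.natAbs (3 * e') ∧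
      Int.gcd (2 * b + a₁ * a * (3 * e' : ℕ) + a₃ * (3 * e' : ℕ) ^ 3)
        (a₁ * b * (3 * e' : ℕ) - (3 * a ^ 2 + 2 * a₂ * a * (3 * e' : ℕ) ^ 2 + a₄ * (3 * e' : ℕ) ^ 4)) ∣ (3 * e') ^ n ∧
      (27 : ℤ) ∣ c4 * c4 ^ 3 + γ * c6 * (c4 ^ 3 + 240 * D) ∧ ¬ (3 : ℤ) ∣ γ ∧ (81 : ℤ) ∣ a * (3 * e' : ℕ) + ζ * b ∧
      (243 : ℤ) ∣ 6 * ζ + 3 * a₁ * ζ ^ 2 + 2 * (a₁ ^ 2 + a₂) * ζ ^ 3 - 6 * ℓ ∧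
      (9 : ℤ) ∣ ω ∧ (243 : ℤ) ∣ ℓ ^ 2 - ω * γ ∧ (9 : ℤ) ∣ κ ∧ (2187 : ℤ) ∣ 360 * ω + 30 * ω ^ 2 + ω ^ 3 - 720 * κ ∧
      9 * u = 2 * γ * κ ∧ ¬ (3 : ℤ) ∣ u ∧
      ¬ (81 : ℤ) ∣ 6 * ((e' : ℤ) ^ 4 - 1) - 3 * ((e' : ℤ) ^ 4 - 1) ^ 2 + 2 * ((e' : ℤ) ^ 4 - 1) ^ 3 -
        6 * (u ^ 2 - 1) + 3 * (u ^ 2 - 1) ^ 2 - 2 * (u ^ 2 - 1) ^ 3)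
    {x y : ℚ} (hx : x = a / ((3 * e' : ℕ) : ℚ) ^ 2) (hy : y = b / ((3 * e' : ℕ) : ℚ) ^ 3)
    (h : W.toAffine.Nonsingular x y) : RegMult.CertNonsplit W 3 (.some x y h) 1 := by
  obtain ⟨hc4, hc6, hD, h3c4, h3c6, h3D, h3e', h3b, hcop, hgcd, hγ, h3γ, hζ, hℓ, hω9, hω, hκ9, hκ, hu, h3u, hcert⟩ := H
  have he'0 : e' ≠ 0 := by rintro rfl; exact h3e' (by simp)
  have he0 : (3 * e' : ℕ) ≠ 0 := by positivity
  have hx1 : 1 < ‖(x : ℚ_[3])‖ := by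
    haveI : Fact (Nat.Prime 3) := ⟨Nat.prime_three⟩
    exact (one_lt_norm_ratCast_iff 3 x).mpr (padicValRat_x_neg he0 hx hcop (dvd_mul_right 3 e'))
  have hadm : W.IsAdmissible 3 (.some x y h) :=
    isAdmissible_of_one_lt_norm (by norm_num) h hx1 (hasNonsingularReductionAt_of_gcd W hW he0 hx hy hcop hgcd)
  refine ⟨by rw [one_smul]; exact hadm, fun q _ hq1 hqj => ?_⟩
  rw [one_smul]
  exact heightFourOneCoord_ne_zero_of_residueCertO2 W (baseChange_a₁_eq W hW) (baseChange_a₂_eq W hW)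
    (baseChange_c₄_eq W hW hc4) (baseChange_c₆_eq W hW hc6) h3c4 h3c6 (ratCast_j_inv_eq W hW hc4 hD) h3D h3e' h3b
    hcop hx hy hγ h3γ hζ hℓ hω9 hω hκ9 hκ hu h3u hcert hq1 hqj

end Summit.BirchSwinnertonDyer.Rank1Residual.X11b.RegMult.KernelCert
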